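import Summits.CriticalPhenomena.Ising3D.Control2DReadoutWindow
import Summits.CriticalPhenomena.Ising3D.Control2DL17BoxYData80
import Summits.CriticalPhenomena.Ising3D.Control2DL17BoxYRegion
import Mathlib.Tactic.NormNum
import Mathlib.Tactic.Linarith
import HarnessLib

/-!
# Readout certificate B17 over a WINDOW: `f(4.10) < f(Δ)` for EVERY `Δ ∈ [2.0625, 4.07]` — the near-zero at `4.10 ± 0.03` is the
least value of the scalar-channel action over the whole window `[2.0625, 4.10 + 0.03]` (cell `pub-ising3x`, seat controls-1 gen 29;
KERNEL, certificate kind "readout", continuum form — CONTROL-ONLY)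

HONEST FRAMING: lottery ticket; floor = tightest certified 3D Ising CFT bounds; no exact-solution
claim without a proof. CONTROL-ONLY (`d = 2`, `Δ_σ = 1/8`); a statement about one of our INSTRUMENTS (the kernel-certified Λ = 17
lower-edge box functional `wtboxY`: the P9(a) object `j195171` (Λ = 17, E₀ = 40; sha256 `960ca02c…`); box `[977/1000, 491/500]`), not about a CFT; nothing about `d = 3`.

`Control2DReadoutB17.dip0_B17` samples `f(Δ) = φ[F^{1/8}_-[g_{Δ,0}]]` at `{4, 4.07, 4.10, 4.10+0.03}`. Here `f(4.10) < f(Δ)` is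
certified for the CONTINUUM `Δ ∈ [33/16, 407 / 100]` by three Bernstein cells of the window polynomial (`Control2DReadoutWindow.windowCheck`:
cell polynomial `phatboxYs0 = cellPolyZ wtboxY slL17 17 0 71` of the landed replay, digit cut `10^490` as in its landed cells, readout truncation
`N = 160`, region threshold `E₀ = 40`). Below `Δ = 2.0625` the action falls to its BINDING zero at the gap edge `Δ = 2` (a boundary zero
of the certificate: `f(2)/f(4.10) ≈ 0.02`), so the window starts just above it. With `dip0_B17` (`f(4.10) < f(4.10 + 0.03)`): over
`[2.0625, 4.10 + 0.03]` the least value is attained only inside `(4.07, 4.10 + 0.03)` — the instrument's first excited near-zero sits at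
`δ₀(17) = 0.10 ± 0.03` above `T T̄ = 4` with NO lower excursion anywhere in `[2.0625, 4.07]`. Zero grant compute. No facts, standard
axioms only. [cite: RattazziEtAl2008, §5.5]
-/

namespace Summit.CriticalPhenomena.Ising3D.Control2D

open Set
open Literature.MathematicalPhysics.QuantumFieldTheory.ConformalBootstrap3D

set_option maxHeartbeats 0 in
set_option maxRecDepth 200000 in
/-- Window cell 1: `y ∈ [33/32, 51/32]` (`Δ ∈ [2.0625, 3.1875]`). [folklore] -/
theorem windowCheck_B17_c1 : windowCheck wtboxY slL17 17 71 490 160 40 (41 / 10) 32 33 18 phatboxYs0 = true := by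
  decide +kernel

set_option maxHeartbeats 0 in
set_option maxRecDepth 200000 in
/-- Window cell 2: `y ∈ [102/64, 121/64]` (`Δ ∈ [3.1875, 3.78125]`). [folklore] -/
theorem windowCheck_B17_c2 : windowCheck wtboxY slL17 17 71 490 160 40 (41 / 10) 64 102 19 phatboxYs0 = true := by
  decide +kernel

set_option maxHeartbeats 0 in
set_option maxRecDepth 200000 in
/-- Window cell 3: `y ∈ [3025/1600, 3256/1600]` (`Δ ∈ [3.78125, 4.07]`). [folklore] -/
theorem windowCheck_B17_c3 : windowCheck wtboxY slL17 17 71 490 160 40 (41 / 10) 1600 3025 231 phatboxYs0 = true := by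
  decide +kernel

set_option maxRecDepth 8192 in
/-- **B17 window readout, kernel-complete**: for `φ = taylorFunctional2D (1/2) slL17 wtboxY` (`Δ_σ = 1/8`, scalar channel) and EVERY
`Δ ∈ [33/16, 407 / 100]`: `f(41 / 10) < f(Δ)`. CONTROL-ONLY (d = 2). [cite: RattazziEtAl2008, §5.5] -/
theorem window_B17 (Δ : ℝ) (h1 : (33 : ℝ) / 16 ≤ Δ) (h2 : Δ ≤ 407 / 100) :
    taylorFunctional2D (1 / 2) slL17.toFinset (fun p => (wtboxY p : ℝ)) (crossF (1 / 8) (-1) (globalBlock (41 / 10) 0)) <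
      taylorFunctional2D (1 / 2) slL17.toFinset (fun p => (wtboxY p : ℝ)) (crossF (1 / 8) (-1) (globalBlock Δ 0)) := by
  have hR := (region_of_kernelCertAuto wtboxY slL17_nodup slL17_deg 17 18 (by norm_num) (by norm_num) PregboxY_eq
      (by decide +kernel) QhatboxY_eq _ cregboxY_n0 cregJboxY (by decide) cregJboxY_ok)
  have em : (((41 / 10 : ℚ)) : ℝ) = 41 / 10 := by norm_num
  rcases le_total Δ (51 / 16) with hA | hA
  · have h := window_lt_of_windowCheck wtboxY slL17_nodup slL17_deg phatboxYs0_eq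
      (fun b J hb hE => hR b J hb (by exact_mod_cast hE)) windowCheck_B17_c1 (Δ := Δ)
      (by push_cast; linarith) (by push_cast; linarith)
    rwa [em] at h
  rcases le_total Δ (121 / 32) with hB | hB
  · have h := window_lt_of_windowCheck wtboxY slL17_nodup slL17_deg phatboxYs0_eq
      (fun b J hb hE => hR b J hb (by exact_mod_cast hE)) windowCheck_B17_c2 (Δ := Δ)
      (by push_cast; linarith) (by push_cast; linarith)
    rwa [em] at h
  · have h := window_lt_of_windowCheck wtboxY slL17_nodup slL17_deg phatboxYs0_eq
      (fun b J hb hE => hR b J hb (by exact_mod_cast hE)) windowCheck_B17_c3 (Δ := Δ)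
      (by push_cast; linarith) (by push_cast; linarith)
    rwa [em] at h

end Summit.CriticalPhenomena.Ising3D.Control2D
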